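import Mathlib
import Summits.Ventures.LatticeQCDFlow.TrivializingMaps.AcceptanceFootprintCurve
import HarnessLib

/-!
# The acceptance curve, range form and the lattice gauge instance (THEOREM Q♯♯, docking)

HONEST FRAMING: exact (Metropolis-corrected) sampling algorithms for lattice gauge theory; figures of merit are
autocorrelation/cost numbers at stated couplings and volumes; no continuum-physics claim.

Venture `LatticeQCDFlow` (cell pub-lqcd), topic `TrivializingMaps`; FANOUT row 28 (theory-1), THEORY-1 §34.
NEW WORK of the cell — the three density-form curve theorems of `AcceptanceFootprintCurve`
(`Curve.two_mul_abs_cov_le_of_meanAccept`, `Curve.abs_cov_le_max_of_meanAccept`,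
`Curve.meanAccept_le_half_of_abs_cov_ge`) docked exactly as the tree docks THEOREM Q
(`abs_cov_le_of_meanAccept_of_range`, `Gauge.abs_cov_boltzmann_le_of_meanAccept`): the factorisation
hypothesis `∫ A B ∂ν = (∫ A ∂ν)(∫ B ∂ν)` is DISCHARGED by `pushforward_integral_mul_eq_of_range` for a
push-forward proposal of RANGE `r` and observables supported more than `2 r` apart; nothing is cited as a fact.

## What is proved (0 `sorry`)

* §1 (link fields `ι → α`, i.i.d. reference `μ₀^ι`, target `π = p · μ₀^ι`, model `Φ_* μ₀^ι` of a measurable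
  map of range `r` with density `q`, equilibrium acceptance `≥ acc`, measurable `|A| ≤ a`, `|B| ≤ b` with
  `0 < a`, `0 < b` supported MORE THAN `2 r` apart):
  **`Curve.two_mul_abs_cov_le_of_meanAccept_of_range`** `2 |Cov_π(A, B)| ≤ (2 - acc)² a b`;
  **`Curve.abs_cov_le_max_of_meanAccept_of_range`** `½ ≤ acc ⟹ |Cov_π(A, B)| ≤ max(8/9, 4 acc (1 - acc)) a b`;
  **`Curve.meanAccept_le_half_of_abs_cov_ge_of_range`** `a b ≤ |Cov_π(A, B)| ⟹ acc ≤ ½` (ACCEPTANCE CEILING);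
  **`Curve.sep_le_two_mul_range_of_meanAccept_max`** (FOOTPRINT LAW on the curve) — a target witness pair at
  separation `≥ sep` with `|Cov| ≥ m > max(8/9, 4 acc (1 - acc)) a b` and `½ ≤ acc` forces `sep ≤ 2 r`.
* §2 the lattice gauge instance `G = SU(n)`, `π = 𝒵⁻¹ e^{-S} D[U]` (`S` continuous), reference `D[U]`, model
  `Φ_* D[V]` with density `q` (integrability and unit mass DERIVED, tree `Gauge.integrable_of_map_eq_withDensity`):
  **`Curve.Gauge.two_mul_abs_cov_boltzmann_le_of_meanAccept`**, **`Curve.Gauge.abs_cov_boltzmann_le_max_of_meanAccept`**,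
  **`Curve.Gauge.meanAccept_le_half_of_abs_cov_boltzmann_ge`**, **`Curve.Gauge.sep_le_two_mul_range_of_meanAccept_max`**.

READING (cost law, no numerics implied).  At EVERY coupling, volume and `SU(n)`: a strictly local flow proposal
of range `r` whose independence sampler runs at equilibrium acceptance `acc ≥ ½` leaves every bounded witness
pair more than `2 r` apart with `|Cov| ≤ max(8/9, 4 acc (1 - acc)) a b` (`= 4 acc (1 - acc) a b` on
`½ ≤ acc ≤ 2/3`, attained there by `Sharp.corner_family`); and a full-strength witness (`|Cov| = a b`, e.g. a
`ℤ₂`-symmetric double well read by two sign observables) more than `2 r` apart caps the acceptance at `½`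
(attained: `Floor`).  NOT CLAIMED: the curve `4 acc (1 - acc)` on `2/3 < acc ≤ 1` (open, THEORY-1 §34);
anything for quasi-local maps; lower bounds on correlations of `𝒵⁻¹ e^{-S} D[U]`.
-/

namespace Summit.Ventures.LatticeQCDFlow.TrivializingMaps.Curve

open MeasureTheory Set
open scoped ENNReal NNReal

/-! ## §1. Range form: push-forward proposals of range `r` on link fields -/

section Range

variable {ι : Type*} [Fintype ι] {α : Type*} [MeasurableSpace α]
variable (μ₀ : Measure α) [IsProbabilityMeasure μ₀]

/-- **THEOREM Q♯♯ (i), range form.**  Link fields `ι → α` with i.i.d. reference law `μ₀^ι`; target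
`π = p · μ₀^ι`; model law the push-forward `Φ_* μ₀^ι` of a measurable map of RANGE `r` with density `q`;
equilibrium acceptance `≥ acc`.  Every pair of measurable observables `|A| ≤ a`, `|B| ≤ b` (`0 < a`, `0 < b`)
supported MORE THAN `2 r` apart has `2 |∫ A B ∂π - (∫ A ∂π)(∫ B ∂π)| ≤ (2 - acc)² a b`. -/
theorem two_mul_abs_cov_le_of_meanAccept_of_range {p q : (ι → α) → ℝ} (hp0 : ∀ x, 0 ≤ p x)
    (hpm : Measurable p) (hpi : Integrable p (Measure.pi fun _ : ι => μ₀))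
    (hp1 : ∫ x, p x ∂(Measure.pi fun _ : ι => μ₀) = 1) (hq0 : ∀ x, 0 ≤ q x) (hqm : Measurable q)
    (hqi : Integrable q (Measure.pi fun _ : ι => μ₀))
    (hq1 : ∫ x, q x ∂(Measure.pi fun _ : ι => μ₀) = 1)
    (d : ι → ι → ℕ) (hsymm : ∀ a b, d a b = d b a) (htri : ∀ a b c, d a c ≤ d a b + d b c)
    {Φ : (ι → α) → (ι → α)} (hΦm : Measurable Φ)
    (hν : (Measure.pi fun _ : ι => μ₀).map Φ
      = (Measure.pi fun _ : ι => μ₀).withDensity fun x => ENNReal.ofReal (q x))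
    {N : ι → Set ι} (hΦ : ∀ i, DependsOn (fun W => Φ W i) (N i)) {r : ℕ}
    (hN : ∀ i, ∀ j ∈ N i, d i j ≤ r) {acc : ℝ}
    (hacc : acc ≤ ∫ x, ∫ y, min (p x * q y) (p y * q x) ∂(Measure.pi fun _ : ι => μ₀)
      ∂(Measure.pi fun _ : ι => μ₀))
    {A B : (ι → α) → ℝ} (hAm : Measurable A) (hBm : Measurable B) {a b : ℝ} (ha : 0 < a)
    (hb : 0 < b) (hAa : ∀ x, |A x| ≤ a) (hBb : ∀ x, |B x| ≤ b) {S T : Set ι} (hA : DependsOn A S)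
    (hB : DependsOn B T)
    (hsep : ∀ i ∈ S, ∀ j ∈ T, 2 * r < d i j) :
    2 * |∫ U, A U * B U ∂((Measure.pi fun _ : ι => μ₀).withDensity fun x => ENNReal.ofReal (p x))
        - (∫ U, A U ∂((Measure.pi fun _ : ι => μ₀).withDensity fun x => ENNReal.ofReal (p x)))
          * ∫ U, B U ∂((Measure.pi fun _ : ι => μ₀).withDensity fun x => ENNReal.ofReal (p x))|
      ≤ (2 - acc) ^ 2 * (a * b) := by
  have hfac := pushforward_integral_mul_eq_of_range μ₀ d hsymm htri hΦm hΦ hN hAm hBm hA hB hsep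
  rw [hν] at hfac
  exact two_mul_abs_cov_le_of_meanAccept hp0 hpm hpi hp1 hq0 hqm hqi hq1 hacc hAm hBm ha hb hAa hBb
    hfac

/-- **THEOREM Q♯♯ (ii), range form (the exact curve on `½ ≤ acc ≤ 2/3`).**  Same setting, `½ ≤ acc`:
`|∫ A B ∂π - (∫ A ∂π)(∫ B ∂π)| ≤ max(8/9, 4 acc (1 - acc)) a b`. -/
theorem abs_cov_le_max_of_meanAccept_of_range {p q : (ι → α) → ℝ} (hp0 : ∀ x, 0 ≤ p x)
    (hpm : Measurable p) (hpi : Integrable p (Measure.pi fun _ : ι => μ₀))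
    (hp1 : ∫ x, p x ∂(Measure.pi fun _ : ι => μ₀) = 1) (hq0 : ∀ x, 0 ≤ q x) (hqm : Measurable q)
    (hqi : Integrable q (Measure.pi fun _ : ι => μ₀))
    (hq1 : ∫ x, q x ∂(Measure.pi fun _ : ι => μ₀) = 1)
    (d : ι → ι → ℕ) (hsymm : ∀ a b, d a b = d b a) (htri : ∀ a b c, d a c ≤ d a b + d b c)
    {Φ : (ι → α) → (ι → α)} (hΦm : Measurable Φ)
    (hν : (Measure.pi fun _ : ι => μ₀).map Φ
      = (Measure.pi fun _ : ι => μ₀).withDensity fun x => ENNReal.ofReal (q x))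
    {N : ι → Set ι} (hΦ : ∀ i, DependsOn (fun W => Φ W i) (N i)) {r : ℕ}
    (hN : ∀ i, ∀ j ∈ N i, d i j ≤ r) {acc : ℝ}
    (hacc : acc ≤ ∫ x, ∫ y, min (p x * q y) (p y * q x) ∂(Measure.pi fun _ : ι => μ₀)
      ∂(Measure.pi fun _ : ι => μ₀)) (hacc2 : 1 / 2 ≤ acc)
    {A B : (ι → α) → ℝ} (hAm : Measurable A) (hBm : Measurable B) {a b : ℝ} (ha : 0 < a)
    (hb : 0 < b) (hAa : ∀ x, |A x| ≤ a) (hBb : ∀ x, |B x| ≤ b) {S T : Set ι} (hA : DependsOn A S)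
    (hB : DependsOn B T)
    (hsep : ∀ i ∈ S, ∀ j ∈ T, 2 * r < d i j) :
    |∫ U, A U * B U ∂((Measure.pi fun _ : ι => μ₀).withDensity fun x => ENNReal.ofReal (p x))
        - (∫ U, A U ∂((Measure.pi fun _ : ι => μ₀).withDensity fun x => ENNReal.ofReal (p x)))
          * ∫ U, B U ∂((Measure.pi fun _ : ι => μ₀).withDensity fun x => ENNReal.ofReal (p x))|
      ≤ max (8 / 9) (4 * acc * (1 - acc)) * (a * b) := by
  have hfac := pushforward_integral_mul_eq_of_range μ₀ d hsymm htri hΦm hΦ hN hAm hBm hA hB hsep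
  rw [hν] at hfac
  exact abs_cov_le_max_of_meanAccept hp0 hpm hpi hp1 hq0 hqm hqi hq1 hacc hacc2 hAm hBm ha hb
    hAa hBb hfac

/-- **ACCEPTANCE CEILING, range form (THEOREM Q♯♯ (iii)).**  Same setting: if some pair of measurable
observables `|A| ≤ a`, `|B| ≤ b` (`0 < a`, `0 < b`) supported more than `2 r` apart is correlated AT FULL
STRENGTH under the target, `a b ≤ |∫ A B ∂π - (∫ A ∂π)(∫ B ∂π)|`, then the equilibrium acceptance of the
range-`r` push-forward proposal is at most `½`. -/
theorem meanAccept_le_half_of_abs_cov_ge_of_range {p q : (ι → α) → ℝ} (hp0 : ∀ x, 0 ≤ p x)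
    (hpm : Measurable p) (hpi : Integrable p (Measure.pi fun _ : ι => μ₀))
    (hp1 : ∫ x, p x ∂(Measure.pi fun _ : ι => μ₀) = 1) (hq0 : ∀ x, 0 ≤ q x) (hqm : Measurable q)
    (hqi : Integrable q (Measure.pi fun _ : ι => μ₀))
    (hq1 : ∫ x, q x ∂(Measure.pi fun _ : ι => μ₀) = 1)
    (d : ι → ι → ℕ) (hsymm : ∀ a b, d a b = d b a) (htri : ∀ a b c, d a c ≤ d a b + d b c)
    {Φ : (ι → α) → (ι → α)} (hΦm : Measurable Φ)
    (hν : (Measure.pi fun _ : ι => μ₀).map Φ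
      = (Measure.pi fun _ : ι => μ₀).withDensity fun x => ENNReal.ofReal (q x))
    {N : ι → Set ι} (hΦ : ∀ i, DependsOn (fun W => Φ W i) (N i)) {r : ℕ}
    (hN : ∀ i, ∀ j ∈ N i, d i j ≤ r) {acc : ℝ}
    (hacc : acc ≤ ∫ x, ∫ y, min (p x * q y) (p y * q x) ∂(Measure.pi fun _ : ι => μ₀)
      ∂(Measure.pi fun _ : ι => μ₀))
    {A B : (ι → α) → ℝ} (hAm : Measurable A) (hBm : Measurable B) {a b : ℝ} (ha : 0 < a)
    (hb : 0 < b) (hAa : ∀ x, |A x| ≤ a) (hBb : ∀ x, |B x| ≤ b) {S T : Set ι} (hA : DependsOn A S)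
    (hB : DependsOn B T)
    (hsep : ∀ i ∈ S, ∀ j ∈ T, 2 * r < d i j)
    (hfull : a * b ≤
      |∫ U, A U * B U ∂((Measure.pi fun _ : ι => μ₀).withDensity fun x => ENNReal.ofReal (p x))
        - (∫ U, A U ∂((Measure.pi fun _ : ι => μ₀).withDensity fun x => ENNReal.ofReal (p x)))
          * ∫ U, B U ∂((Measure.pi fun _ : ι => μ₀).withDensity fun x => ENNReal.ofReal (p x))|) :
    acc ≤ 1 / 2 := by
  have hfac := pushforward_integral_mul_eq_of_range μ₀ d hsymm htri hΦm hΦ hN hAm hBm hA hB hsep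
  rw [hν] at hfac
  exact meanAccept_le_half_of_abs_cov_ge hp0 hpm hpi hp1 hq0 hqm hqi hq1 hacc hAm hBm ha hb hAa hBb
    hfac hfull

/-- **FOOTPRINT LAW ON THE CURVE.**  Same setting, `½ ≤ acc`: a target witness pair supported AT LEAST `sep`
apart with `|Cov| ≥ m > max(8/9, 4 acc (1 - acc)) a b` forces `sep ≤ 2 r`. -/
theorem sep_le_two_mul_range_of_meanAccept_max {p q : (ι → α) → ℝ} (hp0 : ∀ x, 0 ≤ p x)
    (hpm : Measurable p) (hpi : Integrable p (Measure.pi fun _ : ι => μ₀))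
    (hp1 : ∫ x, p x ∂(Measure.pi fun _ : ι => μ₀) = 1) (hq0 : ∀ x, 0 ≤ q x) (hqm : Measurable q)
    (hqi : Integrable q (Measure.pi fun _ : ι => μ₀))
    (hq1 : ∫ x, q x ∂(Measure.pi fun _ : ι => μ₀) = 1)
    (d : ι → ι → ℕ) (hsymm : ∀ a b, d a b = d b a) (htri : ∀ a b c, d a c ≤ d a b + d b c)
    {Φ : (ι → α) → (ι → α)} (hΦm : Measurable Φ)
    (hν : (Measure.pi fun _ : ι => μ₀).map Φ
      = (Measure.pi fun _ : ι => μ₀).withDensity fun x => ENNReal.ofReal (q x))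
    {N : ι → Set ι} (hΦ : ∀ i, DependsOn (fun W => Φ W i) (N i)) {r : ℕ}
    (hN : ∀ i, ∀ j ∈ N i, d i j ≤ r) {acc : ℝ}
    (hacc : acc ≤ ∫ x, ∫ y, min (p x * q y) (p y * q x) ∂(Measure.pi fun _ : ι => μ₀)
      ∂(Measure.pi fun _ : ι => μ₀)) (hacc2 : 1 / 2 ≤ acc)
    {A B : (ι → α) → ℝ} (hAm : Measurable A) (hBm : Measurable B) {a b : ℝ} (ha : 0 < a)
    (hb : 0 < b) (hAa : ∀ x, |A x| ≤ a) (hBb : ∀ x, |B x| ≤ b) {S T : Set ι} (hA : DependsOn A S)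
    (hB : DependsOn B T) {sep : ℕ} (hfar : ∀ i ∈ S, ∀ j ∈ T, sep ≤ d i j) {m : ℝ}
    (hm : m ≤
      |∫ U, A U * B U ∂((Measure.pi fun _ : ι => μ₀).withDensity fun x => ENNReal.ofReal (p x))
        - (∫ U, A U ∂((Measure.pi fun _ : ι => μ₀).withDensity fun x => ENNReal.ofReal (p x)))
          * ∫ U, B U ∂((Measure.pi fun _ : ι => μ₀).withDensity fun x => ENNReal.ofReal (p x))|)
    (hacc_m : max (8 / 9) (4 * acc * (1 - acc)) * (a * b) < m) : sep ≤ 2 * r := by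
  by_contra hcon
  have hsep : ∀ i ∈ S, ∀ j ∈ T, 2 * r < d i j :=
    fun i hi j hj => lt_of_lt_of_le (not_le.1 hcon) (hfar i hi j hj)
  exact absurd (hm.trans (abs_cov_le_max_of_meanAccept_of_range μ₀ hp0 hpm hpi hp1 hq0 hqm hqi
    hq1 d hsymm htri hΦm hν hΦ hN hacc hacc2 hAm hBm ha hb hAa hBb hA hB hsep)) (not_le.2 hacc_m)

end Range

/-! ## §2. The lattice gauge instance: `π = 𝒵⁻¹ e^{-S} D[U]` on `SU(n)` link fields -/

namespace Gauge

open Literature.MathematicalPhysics.QuantumFieldTheory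
open Literature.MathematicalPhysics.QuantumFieldTheory.Luscher2010

variable {d L n : ℕ} [NeZero L]

/-- **THEOREM Q♯♯ (i) for lattice gauge theory.**  `G = SU(n)`, continuous action `S`, target
`π = 𝒵⁻¹ e^{-S} D[U]`; a measurable proposal map `Φ` of RANGE `r` whose push-forward `Φ_* D[V]` has density
`q ≥ 0` against `D[U]`; the independence sampler on it (exact for `π`) has equilibrium acceptance `≥ acc`.
Then for all measurable `|A| ≤ a`, `|B| ≤ b` (`0 < a`, `0 < b`) on link sets more than `2 r` apart:
`2 |⟨A B⟩ - ⟨A⟩⟨B⟩| ≤ (2 - acc)² a b` (expectations in `π`). -/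
theorem two_mul_abs_cov_boltzmann_le_of_meanAccept
    {S : GaugeConfig d L (Matrix.specialUnitaryGroup (Fin n) ℂ) → ℝ} (hS : Continuous S)
    (dist : Edge d L → Edge d L → ℕ) (hsymm : ∀ e e', dist e e' = dist e' e)
    (htri : ∀ e e' e'', dist e e'' ≤ dist e e' + dist e' e'')
    {Φ : GaugeConfig d L (Matrix.specialUnitaryGroup (Fin n) ℂ) →
      GaugeConfig d L (Matrix.specialUnitaryGroup (Fin n) ℂ)} (hΦm : Measurable Φ)
    {q : GaugeConfig d L (Matrix.specialUnitaryGroup (Fin n) ℂ) → ℝ} (hq0 : ∀ U, 0 ≤ q U)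
    (hqm : Measurable q)
    (hν : (trivialMeasure (Matrix.specialUnitaryGroup (Fin n) ℂ) d L).map Φ
      = (trivialMeasure (Matrix.specialUnitaryGroup (Fin n) ℂ) d L).withDensity
          fun U => ENNReal.ofReal (q U))
    {N : Edge d L → Set (Edge d L)} (hΦ : ∀ e, DependsOn (fun W => Φ W e) (N e)) {r : ℕ}
    (hN : ∀ e, ∀ e' ∈ N e, dist e e' ≤ r) {acc : ℝ}
    (hacc : acc ≤ ∫ U, ∫ U', min (Real.exp (-S U) / (partitionFn S).toReal * q U')
        (Real.exp (-S U') / (partitionFn S).toReal * q U)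
        ∂(trivialMeasure (Matrix.specialUnitaryGroup (Fin n) ℂ) d L)
        ∂(trivialMeasure (Matrix.specialUnitaryGroup (Fin n) ℂ) d L))
    {A B : GaugeConfig d L (Matrix.specialUnitaryGroup (Fin n) ℂ) → ℝ} (hAm : Measurable A)
    (hBm : Measurable B) {a b : ℝ} (ha : 0 < a) (hb : 0 < b) (hAa : ∀ U, |A U| ≤ a)
    (hBb : ∀ U, |B U| ≤ b) {SA SB : Set (Edge d L)} (hA : DependsOn A SA) (hB : DependsOn B SB)
    (hsep : ∀ e ∈ SA, ∀ e' ∈ SB, 2 * r < dist e e') :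
    2 * |∫ U, A U * B U ∂(boltzmannMeasure S)
        - (∫ U, A U ∂(boltzmannMeasure S)) * ∫ U, B U ∂(boltzmannMeasure S)|
      ≤ (2 - acc) ^ 2 * (a * b) := by
  obtain ⟨hp0, hpm, hpi, hp1⟩ := Gauge.density_boltzmann_spec (d := d) (L := L) hS
  obtain ⟨hqi, hq1⟩ := Gauge.integrable_of_map_eq_withDensity (d := d) (L := L) hΦm hq0 hqm hν
  rw [Gauge.boltzmannMeasure_eq_withDensity hS]
  unfold trivialMeasure at hpi hp1 hqi hq1 hν hacc ⊢
  exact two_mul_abs_cov_le_of_meanAccept_of_range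
    (haarProbability (Matrix.specialUnitaryGroup (Fin n) ℂ)) hp0 hpm hpi hp1 hq0 hqm hqi hq1 dist
    hsymm htri hΦm hν hΦ hN hacc hAm hBm ha hb hAa hBb hA hB hsep

/-- **THEOREM Q♯♯ (ii) for lattice gauge theory (the exact curve on `½ ≤ acc ≤ 2/3`).**  Same setting,
`½ ≤ acc`: `|⟨A B⟩ - ⟨A⟩⟨B⟩| ≤ max(8/9, 4 acc (1 - acc)) a b`. -/
theorem abs_cov_boltzmann_le_max_of_meanAccept
    {S : GaugeConfig d L (Matrix.specialUnitaryGroup (Fin n) ℂ) → ℝ} (hS : Continuous S)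
    (dist : Edge d L → Edge d L → ℕ) (hsymm : ∀ e e', dist e e' = dist e' e)
    (htri : ∀ e e' e'', dist e e'' ≤ dist e e' + dist e' e'')
    {Φ : GaugeConfig d L (Matrix.specialUnitaryGroup (Fin n) ℂ) →
      GaugeConfig d L (Matrix.specialUnitaryGroup (Fin n) ℂ)} (hΦm : Measurable Φ)
    {q : GaugeConfig d L (Matrix.specialUnitaryGroup (Fin n) ℂ) → ℝ} (hq0 : ∀ U, 0 ≤ q U)
    (hqm : Measurable q)
    (hν : (trivialMeasure (Matrix.specialUnitaryGroup (Fin n) ℂ) d L).map Φ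
      = (trivialMeasure (Matrix.specialUnitaryGroup (Fin n) ℂ) d L).withDensity
          fun U => ENNReal.ofReal (q U))
    {N : Edge d L → Set (Edge d L)} (hΦ : ∀ e, DependsOn (fun W => Φ W e) (N e)) {r : ℕ}
    (hN : ∀ e, ∀ e' ∈ N e, dist e e' ≤ r) {acc : ℝ}
    (hacc : acc ≤ ∫ U, ∫ U', min (Real.exp (-S U) / (partitionFn S).toReal * q U')
        (Real.exp (-S U') / (partitionFn S).toReal * q U)
        ∂(trivialMeasure (Matrix.specialUnitaryGroup (Fin n) ℂ) d L)
        ∂(trivialMeasure (Matrix.specialUnitaryGroup (Fin n) ℂ) d L)) (hacc2 : 1 / 2 ≤ acc)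
    {A B : GaugeConfig d L (Matrix.specialUnitaryGroup (Fin n) ℂ) → ℝ} (hAm : Measurable A)
    (hBm : Measurable B) {a b : ℝ} (ha : 0 < a) (hb : 0 < b) (hAa : ∀ U, |A U| ≤ a)
    (hBb : ∀ U, |B U| ≤ b) {SA SB : Set (Edge d L)} (hA : DependsOn A SA) (hB : DependsOn B SB)
    (hsep : ∀ e ∈ SA, ∀ e' ∈ SB, 2 * r < dist e e') :
    |∫ U, A U * B U ∂(boltzmannMeasure S)
        - (∫ U, A U ∂(boltzmannMeasure S)) * ∫ U, B U ∂(boltzmannMeasure S)|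
      ≤ max (8 / 9) (4 * acc * (1 - acc)) * (a * b) := by
  obtain ⟨hp0, hpm, hpi, hp1⟩ := Gauge.density_boltzmann_spec (d := d) (L := L) hS
  obtain ⟨hqi, hq1⟩ := Gauge.integrable_of_map_eq_withDensity (d := d) (L := L) hΦm hq0 hqm hν
  rw [Gauge.boltzmannMeasure_eq_withDensity hS]
  unfold trivialMeasure at hpi hp1 hqi hq1 hν hacc ⊢
  exact abs_cov_le_max_of_meanAccept_of_range
    (haarProbability (Matrix.specialUnitaryGroup (Fin n) ℂ)) hp0 hpm hpi hp1 hq0 hqm hqi hq1 dist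
    hsymm htri hΦm hν hΦ hN hacc hacc2 hAm hBm ha hb hAa hBb hA hB hsep

/-- **ACCEPTANCE CEILING for lattice gauge theory (THEOREM Q♯♯ (iii)).**  Same setting, at ANY coupling:
if two measurable observables `|A| ≤ a`, `|B| ≤ b` (`0 < a`, `0 < b`) on link sets more than `2 r` apart are
correlated at full strength under `𝒵⁻¹ e^{-S} D[U]`, `a b ≤ |⟨A B⟩ - ⟨A⟩⟨B⟩|`, then every range-`r`
push-forward proposal has equilibrium acceptance `≤ ½`. -/
theorem meanAccept_le_half_of_abs_cov_boltzmann_ge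
    {S : GaugeConfig d L (Matrix.specialUnitaryGroup (Fin n) ℂ) → ℝ} (hS : Continuous S)
    (dist : Edge d L → Edge d L → ℕ) (hsymm : ∀ e e', dist e e' = dist e' e)
    (htri : ∀ e e' e'', dist e e'' ≤ dist e e' + dist e' e'')
    {Φ : GaugeConfig d L (Matrix.specialUnitaryGroup (Fin n) ℂ) →
      GaugeConfig d L (Matrix.specialUnitaryGroup (Fin n) ℂ)} (hΦm : Measurable Φ)
    {q : GaugeConfig d L (Matrix.specialUnitaryGroup (Fin n) ℂ) → ℝ} (hq0 : ∀ U, 0 ≤ q U)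
    (hqm : Measurable q)
    (hν : (trivialMeasure (Matrix.specialUnitaryGroup (Fin n) ℂ) d L).map Φ
      = (trivialMeasure (Matrix.specialUnitaryGroup (Fin n) ℂ) d L).withDensity
          fun U => ENNReal.ofReal (q U))
    {N : Edge d L → Set (Edge d L)} (hΦ : ∀ e, DependsOn (fun W => Φ W e) (N e)) {r : ℕ}
    (hN : ∀ e, ∀ e' ∈ N e, dist e e' ≤ r) {acc : ℝ}
    (hacc : acc ≤ ∫ U, ∫ U', min (Real.exp (-S U) / (partitionFn S).toReal * q U')
        (Real.exp (-S U') / (partitionFn S).toReal * q U)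
        ∂(trivialMeasure (Matrix.specialUnitaryGroup (Fin n) ℂ) d L)
        ∂(trivialMeasure (Matrix.specialUnitaryGroup (Fin n) ℂ) d L))
    {A B : GaugeConfig d L (Matrix.specialUnitaryGroup (Fin n) ℂ) → ℝ} (hAm : Measurable A)
    (hBm : Measurable B) {a b : ℝ} (ha : 0 < a) (hb : 0 < b) (hAa : ∀ U, |A U| ≤ a)
    (hBb : ∀ U, |B U| ≤ b) {SA SB : Set (Edge d L)} (hA : DependsOn A SA) (hB : DependsOn B SB)
    (hsep : ∀ e ∈ SA, ∀ e' ∈ SB, 2 * r < dist e e')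
    (hfull : a * b ≤ |∫ U, A U * B U ∂(boltzmannMeasure S)
        - (∫ U, A U ∂(boltzmannMeasure S)) * ∫ U, B U ∂(boltzmannMeasure S)|) :
    acc ≤ 1 / 2 := by
  obtain ⟨hp0, hpm, hpi, hp1⟩ := Gauge.density_boltzmann_spec (d := d) (L := L) hS
  obtain ⟨hqi, hq1⟩ := Gauge.integrable_of_map_eq_withDensity (d := d) (L := L) hΦm hq0 hqm hν
  rw [Gauge.boltzmannMeasure_eq_withDensity hS] at hfull
  unfold trivialMeasure at hpi hp1 hqi hq1 hν hacc hfull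
  exact meanAccept_le_half_of_abs_cov_ge_of_range
    (haarProbability (Matrix.specialUnitaryGroup (Fin n) ℂ)) hp0 hpm hpi hp1 hq0 hqm hqi hq1 dist
    hsymm htri hΦm hν hΦ hN hacc hAm hBm ha hb hAa hBb hA hB hsep hfull

/-- **FOOTPRINT LAW ON THE CURVE for lattice gauge theory.**  Same setting, `½ ≤ acc`; a witness pair at
separation `≥ sep` with connected correlation `≥ m > max(8/9, 4 acc (1 - acc)) a b` under `𝒵⁻¹ e^{-S} D[U]`
forces `sep ≤ 2 r`. -/
theorem sep_le_two_mul_range_of_meanAccept_max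
    {S : GaugeConfig d L (Matrix.specialUnitaryGroup (Fin n) ℂ) → ℝ} (hS : Continuous S)
    (dist : Edge d L → Edge d L → ℕ) (hsymm : ∀ e e', dist e e' = dist e' e)
    (htri : ∀ e e' e'', dist e e'' ≤ dist e e' + dist e' e'')
    {Φ : GaugeConfig d L (Matrix.specialUnitaryGroup (Fin n) ℂ) →
      GaugeConfig d L (Matrix.specialUnitaryGroup (Fin n) ℂ)} (hΦm : Measurable Φ)
    {q : GaugeConfig d L (Matrix.specialUnitaryGroup (Fin n) ℂ) → ℝ} (hq0 : ∀ U, 0 ≤ q U)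
    (hqm : Measurable q)
    (hν : (trivialMeasure (Matrix.specialUnitaryGroup (Fin n) ℂ) d L).map Φ
      = (trivialMeasure (Matrix.specialUnitaryGroup (Fin n) ℂ) d L).withDensity
          fun U => ENNReal.ofReal (q U))
    {N : Edge d L → Set (Edge d L)} (hΦ : ∀ e, DependsOn (fun W => Φ W e) (N e)) {r : ℕ}
    (hN : ∀ e, ∀ e' ∈ N e, dist e e' ≤ r) {acc : ℝ}
    (hacc : acc ≤ ∫ U, ∫ U', min (Real.exp (-S U) / (partitionFn S).toReal * q U')
        (Real.exp (-S U') / (partitionFn S).toReal * q U)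
        ∂(trivialMeasure (Matrix.specialUnitaryGroup (Fin n) ℂ) d L)
        ∂(trivialMeasure (Matrix.specialUnitaryGroup (Fin n) ℂ) d L)) (hacc2 : 1 / 2 ≤ acc)
    {A B : GaugeConfig d L (Matrix.specialUnitaryGroup (Fin n) ℂ) → ℝ} (hAm : Measurable A)
    (hBm : Measurable B) {a b : ℝ} (ha : 0 < a) (hb : 0 < b) (hAa : ∀ U, |A U| ≤ a)
    (hBb : ∀ U, |B U| ≤ b) {SA SB : Set (Edge d L)} (hA : DependsOn A SA) (hB : DependsOn B SB)
    {sep : ℕ} (hfar : ∀ e ∈ SA, ∀ e' ∈ SB, sep ≤ dist e e') {m : ℝ}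
    (hm : m ≤ |∫ U, A U * B U ∂(boltzmannMeasure S)
        - (∫ U, A U ∂(boltzmannMeasure S)) * ∫ U, B U ∂(boltzmannMeasure S)|)
    (hacc_m : max (8 / 9) (4 * acc * (1 - acc)) * (a * b) < m) : sep ≤ 2 * r := by
  by_contra hcon
  have hsep : ∀ e ∈ SA, ∀ e' ∈ SB, 2 * r < dist e e' :=
    fun e he e' he' => lt_of_lt_of_le (not_le.1 hcon) (hfar e he e' he')
  exact absurd (hm.trans (abs_cov_boltzmann_le_max_of_meanAccept hS dist hsymm htri hΦm hq0 hqm hν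
    hΦ hN hacc hacc2 hAm hBm ha hb hAa hBb hA hB hsep)) (not_le.2 hacc_m)

end Gauge

end Summit.Ventures.LatticeQCDFlow.TrivializingMaps.Curve
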